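import Mathlib

/-!
# A product model hosts separated unitriangular triples (stub `stub_modelHosts`)

Line `registered` (`Lines/birth.lean`) for the crux `NilpotentLieHosts.UnitriangularCostShape`
(`stmt-MatrixMultiplication-7724`): the BCGPU24 Thm 2.2 / Rem 2.4 hosting mechanism.

**Claim.** Write `R = ℂ[z₁,…,z_k]/(zᵢ^t)` and let `ρ : SL_d(ℤ) → M_N(R)` be a *product model at
level `s`*: for every polynomial `p` in the matrix entries of `(j-i)`-weighted degree `≤ s` there is
a `ℂ`-linear functional `ℓ_p` on `M_N(R)` with `ℓ_p (ρ g · ρ h) = p(g h)` for all upper unitriangular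
`g, h`.  If `X, Y, Z ⊂ SL_d(ℤ)` are finite sets of upper unitriangular matrices carrying separating
polynomials `p_{x₀ z₀}` of weighted degree `≤ s`, i.e.
`p_{x₀ z₀}(x y⁻¹ y' z⁻¹) = [x = x₀ ∧ y = y' ∧ z = z₀]` on `X × Y × Y × Z`, then the matrix
multiplication map `⟨|X|,|Y|,|Z|⟩` is hosted by `M_N(R)`: there are `ℂ`-linear `α, β, γ` with
`γ (α M · β M') = M M'`.

**Proof.** Enumerate `X, Y, Z` by `Finset.equivFin` and put
`α M = Σ_{a b} M_{ab} • ρ(x_a y_b⁻¹)`, `β M' = Σ_{b c} M'_{bc} • ρ(y_b z_c⁻¹)` and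
`γ T = (ℓ_{p_{x_a z_c}} T)_{a c}` (`hosting_of_pattern`).  Upper unitriangular matrices are closed
under products and inverses (`unitriangular_mul`, `unitriangular_inv`: the inverse is block
triangular by `Matrix.blockTriangular_inv_of_blockTriangular` and its diagonal is read off
`g⁻¹ g = 1`), so `ℓ (ρ(x y⁻¹) ρ(y' z⁻¹)) = p(x y⁻¹ y' z⁻¹)`; bilinearity of the product and the
separation pattern collapse the fourfold sum to `Σ_b M_{ab} M'_{bc}` (`sum_sep_pattern`).

Supports item `stmt-MatrixMultiplication-7724`; Mathlib only, no definitions, no named unproved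
facts.
-/

-- the tree's namespace `Summit.MatrixMultiplication.MatrixMultiplication.…` repeats a component
-- by design
set_option linter.dupNamespace false

namespace Summit.MatrixMultiplication.MatrixMultiplication.Theorems.UnitriangularCostShape

open scoped BigOperators Matrix

namespace StubModelHosts

/-! ### Upper unitriangular integer matrices are closed under products and inverses -/

/-- The product of two upper unitriangular matrices is upper unitriangular. -/
theorem unitriangular_mul {d : ℕ} {g h : Matrix (Fin d) (Fin d) ℤ}
    (hg : ∀ i j : Fin d, j ≤ i → g i j = if i = j then 1 else 0)
    (hh : ∀ i j : Fin d, j ≤ i → h i j = if i = j then 1 else 0) :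
    ∀ i j : Fin d, j ≤ i → (g * h) i j = if i = j then 1 else 0 := by
  intro i j hji
  have key : ∀ m : Fin d, g i m * h m j = if i = m then h m j else 0 := by
    intro m
    by_cases him : m ≤ i
    · rw [hg i m him]
      split_ifs <;> simp
    · have hjm : j < m := lt_of_le_of_lt hji (not_le.mp him)
      have hne : ¬ i = m := fun e => him (e ▸ le_refl m)
      rw [hh m j hjm.le, if_neg hjm.ne', if_neg hne, mul_zero]
  rw [Matrix.mul_apply, Finset.sum_congr rfl fun m _ => key m]
  simp only [Finset.sum_ite_eq, Finset.mem_univ, if_true]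
  exact hh i j hji

/-- The inverse (taken in `SL_d(ℤ)`) of an upper unitriangular matrix is upper unitriangular: it is
block triangular (`Matrix.blockTriangular_inv_of_blockTriangular`), and its diagonal entries are
read off the diagonal of `g⁻¹ g = 1`. -/
theorem unitriangular_inv {d : ℕ} (g : Matrix.SpecialLinearGroup (Fin d) ℤ)
    (hg : ∀ i j : Fin d, j ≤ i → (g : Matrix (Fin d) (Fin d) ℤ) i j = if i = j then 1 else 0) :
    ∀ i j : Fin d, j ≤ i →
      ((g⁻¹ : Matrix.SpecialLinearGroup (Fin d) ℤ) : Matrix (Fin d) (Fin d) ℤ) i j =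
        if i = j then 1 else 0 := by
  have hGH : (g : Matrix (Fin d) (Fin d) ℤ) *
      ((g⁻¹ : Matrix.SpecialLinearGroup (Fin d) ℤ) : Matrix (Fin d) (Fin d) ℤ) = 1 := by
    rw [← Matrix.SpecialLinearGroup.coe_mul, mul_inv_cancel, Matrix.SpecialLinearGroup.coe_one]
  have hHG : ((g⁻¹ : Matrix.SpecialLinearGroup (Fin d) ℤ) : Matrix (Fin d) (Fin d) ℤ) *
      (g : Matrix (Fin d) (Fin d) ℤ) = 1 := by
    rw [← Matrix.SpecialLinearGroup.coe_mul, inv_mul_cancel, Matrix.SpecialLinearGroup.coe_one]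
  have hBT : (g : Matrix (Fin d) (Fin d) ℤ).BlockTriangular id := by
    intro i j hij
    replace hij : j < i := hij
    have h := hg i j hij.le
    rwa [if_neg hij.ne'] at h
  letI : Invertible (g : Matrix (Fin d) (Fin d) ℤ) := ⟨_, hHG, hGH⟩
  have hBT' : ((g⁻¹ : Matrix.SpecialLinearGroup (Fin d) ℤ) :
      Matrix (Fin d) (Fin d) ℤ).BlockTriangular id := by
    have h := Matrix.blockTriangular_inv_of_blockTriangular hBT
    rwa [Matrix.inv_eq_right_inv hGH] at h
  intro i j hji
  rcases hji.lt_or_eq with hlt | heq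
  · rw [if_neg hlt.ne']
    exact hBT' hlt
  · rw [heq, if_pos rfl]
    have h1 := congr_fun (congr_fun hHG i) i
    rw [Matrix.mul_apply, Matrix.one_apply_eq, Finset.sum_eq_single i, hg i i le_rfl, if_pos rfl,
      mul_one] at h1
    · exact h1
    · intro m _ hmi
      rcases lt_or_gt_of_ne hmi with hlt | hlt
      · rw [hBT' hlt, zero_mul]
      · rw [hBT hlt, mul_zero]
    · exact fun h => absurd (Finset.mem_univ i) h

/-- `g h⁻¹` is upper unitriangular for upper unitriangular `g, h ∈ SL_d(ℤ)`. -/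
theorem unitriangular_mul_inv {d : ℕ} (g h : Matrix.SpecialLinearGroup (Fin d) ℤ)
    (hg : ∀ i j : Fin d, j ≤ i → (g : Matrix (Fin d) (Fin d) ℤ) i j = if i = j then 1 else 0)
    (hh : ∀ i j : Fin d, j ≤ i → (h : Matrix (Fin d) (Fin d) ℤ) i j = if i = j then 1 else 0) :
    ∀ i j : Fin d, j ≤ i →
      ((g * h⁻¹ : Matrix.SpecialLinearGroup (Fin d) ℤ) : Matrix (Fin d) (Fin d) ℤ) i j =
        if i = j then 1 else 0 := by
  rw [Matrix.SpecialLinearGroup.coe_mul]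
  exact unitriangular_mul hg (unitriangular_inv h hh)

/-! ### Linear bookkeeping: synthesis and readout maps -/

section Readout

variable {A : Type*} [Semiring A] [Module ℂ A]

/-- The separation pattern `[a' = a ∧ b = b' ∧ c' = c]` collapses the fourfold sum to a matrix
product. -/
theorem sum_sep_pattern {m n p : ℕ} (M : Matrix (Fin m) (Fin n) ℂ) (M' : Matrix (Fin n) (Fin p) ℂ)
    (a : Fin m) (c : Fin p) :
    (∑ a', ∑ b, ∑ b', ∑ c',
        M a' b * M' b' c' * (if a' = a ∧ b = b' ∧ c' = c then (1 : ℂ) else 0)) = (M * M') a c := by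
  rw [Matrix.mul_apply, Finset.sum_eq_single a]
  · refine Finset.sum_congr rfl fun b _ => ?_
    rw [Finset.sum_eq_single b]
    · rw [Finset.sum_eq_single c]
      · simp
      · intro c' _ hc'
        simp [hc']
      · simp
    · intro b' _ hb'
      simp [Ne.symm hb']
    · simp
  · intro a' _ ha'
    simp [ha']
  · simp

variable [IsScalarTower ℂ A A] [SMulCommClass ℂ A A]

/-- **Hosting from a separation pattern.** If the linear functionals `ℓ a c : A → ℂ` read the
separation pattern `[a' = a ∧ b = b' ∧ c' = c]` on the products `F a' b * G b' c'`, then the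
synthesis maps `α M = Σ_{a b} M_{ab} • F a b`, `β M' = Σ_{b c} M'_{bc} • G b c` and the readout map
`γ T = (ℓ a c T)_{a c}` host matrix multiplication in `A`: `γ (α M * β M') = M * M'`. -/
theorem hosting_of_pattern {m n p : ℕ} (F : Fin m → Fin n → A) (G : Fin n → Fin p → A)
    (ℓ : Fin m → Fin p → (A →ₗ[ℂ] ℂ))
    (h : ∀ a c a' b b' c', ℓ a c (F a' b * G b' c') = if a' = a ∧ b = b' ∧ c' = c then 1 else 0) :
    ∃ (α : Matrix (Fin m) (Fin n) ℂ →ₗ[ℂ] A) (β : Matrix (Fin n) (Fin p) ℂ →ₗ[ℂ] A)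
      (γ : A →ₗ[ℂ] Matrix (Fin m) (Fin p) ℂ),
      ∀ (M : Matrix (Fin m) (Fin n) ℂ) (M' : Matrix (Fin n) (Fin p) ℂ), γ (α M * β M') = M * M' := by
  refine
    ⟨{ toFun := fun M => ∑ a, ∑ b, M a b • F a b
       map_add' := fun M M' => by
         simp only [Matrix.add_apply, add_smul, Finset.sum_add_distrib]
       map_smul' := fun x M => by
         simp only [Matrix.smul_apply, smul_eq_mul, mul_smul, RingHom.id_apply, Finset.smul_sum] },
      { toFun := fun M' => ∑ b, ∑ c, M' b c • G b c
        map_add' := fun M M' => by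
          simp only [Matrix.add_apply, add_smul, Finset.sum_add_distrib]
        map_smul' := fun x M => by
          simp only [Matrix.smul_apply, smul_eq_mul, mul_smul, RingHom.id_apply, Finset.smul_sum] },
      { toFun := fun T => Matrix.of fun a c => ℓ a c T
        map_add' := fun T T' => by
          ext a c
          simp only [map_add, Matrix.of_apply, Matrix.add_apply]
        map_smul' := fun x T => by
          ext a c
          simp only [map_smul, Matrix.of_apply, Matrix.smul_apply, RingHom.id_apply] },
      fun M M' => ?_⟩
  ext a c
  simp only [LinearMap.coe_mk, AddHom.coe_mk, Matrix.of_apply]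
  simp_rw [Finset.sum_mul, Finset.mul_sum, smul_mul_smul_comm, map_sum, map_smul, h, smul_eq_mul]
  exact sum_sep_pattern M M' a c

end Readout

end StubModelHosts

open StubModelHosts in
/-- STUB 2 — A PRODUCT MODEL HOSTS SEPARATED TRIPLES (BCGPU24 Thm 2.2 / Rem 2.4 mechanism).  Given
`ρ, ℓ` (a product model at level `s`) and upper unitriangular `X, Y, Z ⊂ SL_d(ℤ)` with separating
polynomials of weighted degree `≤ s`, the matrix multiplication tensor `⟨|X|,|Y|,|Z|⟩` is hosted by
`M_N(ℂ[z₁..z_k]/(zᵢ^t))`: `α(M) = Σ M_{xy} ρ(x y⁻¹)`, `β(M') = Σ M'_{y'z} ρ(y' z⁻¹)`,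
`γ = (ℓ_{x₀z₀})`, `γ(α(M) β(M')) = M M'`. -/
theorem stub_modelHosts :
    ∀ (d k t N s : ℕ)
      (ρ : Matrix.SpecialLinearGroup (Fin d) ℤ →
        Matrix (Fin N) (Fin N) (MvPolynomial (Fin k) ℂ ⧸
          Ideal.span (Set.range fun i : Fin k => (MvPolynomial.X i : MvPolynomial (Fin k) ℂ) ^ t)))
      (X Y Z : Finset (Matrix.SpecialLinearGroup (Fin d) ℤ)),
      (∀ p : MvPolynomial (Fin d × Fin d) ℂ,
          MvPolynomial.weightedTotalDegree (fun ij : Fin d × Fin d => (ij.2 : ℕ) - ij.1) p ≤ s →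
          ∃ ℓ : Matrix (Fin N) (Fin N) (MvPolynomial (Fin k) ℂ ⧸
              Ideal.span (Set.range fun i : Fin k => (MvPolynomial.X i : MvPolynomial (Fin k) ℂ) ^ t))
              →ₗ[ℂ] ℂ,
            ∀ g h : Matrix.SpecialLinearGroup (Fin d) ℤ,
              (∀ i j : Fin d, j ≤ i → (g : Matrix (Fin d) (Fin d) ℤ) i j = if i = j then 1 else 0) →
              (∀ i j : Fin d, j ≤ i → (h : Matrix (Fin d) (Fin d) ℤ) i j = if i = j then 1 else 0) →
              ℓ (ρ g * ρ h) = MvPolynomial.eval (fun ij : Fin d × Fin d =>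
                (((g * h : Matrix.SpecialLinearGroup (Fin d) ℤ) : Matrix (Fin d) (Fin d) ℤ) ij.1 ij.2 : ℂ)) p) →
      (∀ g ∈ X ∪ Y ∪ Z, ∀ i j : Fin d, j ≤ i → (g : Matrix (Fin d) (Fin d) ℤ) i j = if i = j then 1 else 0) →
      (∀ x₀ ∈ X, ∀ z₀ ∈ Z, ∃ p : MvPolynomial (Fin d × Fin d) ℂ,
          MvPolynomial.weightedTotalDegree (fun ij : Fin d × Fin d => (ij.2 : ℕ) - ij.1) p ≤ s ∧
          ∀ x ∈ X, ∀ y ∈ Y, ∀ y' ∈ Y, ∀ z ∈ Z,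
            MvPolynomial.eval (fun ij : Fin d × Fin d =>
              (((x * y⁻¹ * y' * z⁻¹ : Matrix.SpecialLinearGroup (Fin d) ℤ) : Matrix (Fin d) (Fin d) ℤ)
                ij.1 ij.2 : ℂ)) p = if x = x₀ ∧ y = y' ∧ z = z₀ then 1 else 0) →
      ∃ (α : Matrix (Fin X.card) (Fin Y.card) ℂ →ₗ[ℂ]
            Matrix (Fin N) (Fin N) (MvPolynomial (Fin k) ℂ ⧸
              Ideal.span (Set.range fun i : Fin k => (MvPolynomial.X i : MvPolynomial (Fin k) ℂ) ^ t)))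
        (β : Matrix (Fin Y.card) (Fin Z.card) ℂ →ₗ[ℂ]
            Matrix (Fin N) (Fin N) (MvPolynomial (Fin k) ℂ ⧸
              Ideal.span (Set.range fun i : Fin k => (MvPolynomial.X i : MvPolynomial (Fin k) ℂ) ^ t)))
        (γ : Matrix (Fin N) (Fin N) (MvPolynomial (Fin k) ℂ ⧸
              Ideal.span (Set.range fun i : Fin k => (MvPolynomial.X i : MvPolynomial (Fin k) ℂ) ^ t))
            →ₗ[ℂ] Matrix (Fin X.card) (Fin Z.card) ℂ),
        ∀ (M : Matrix (Fin X.card) (Fin Y.card) ℂ) (M' : Matrix (Fin Y.card) (Fin Z.card) ℂ),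
          γ (α M * β M') = M * M' := by
  intro d k t N s ρ X Y Z hρ hU hS
  obtain ⟨eX⟩ : Nonempty (Fin X.card ≃ X) := ⟨X.equivFin.symm⟩
  obtain ⟨eY⟩ : Nonempty (Fin Y.card ≃ Y) := ⟨Y.equivFin.symm⟩
  obtain ⟨eZ⟩ : Nonempty (Fin Z.card ≃ Z) := ⟨Z.equivFin.symm⟩
  have hX : ∀ a : Fin X.card, ∀ i j : Fin d, j ≤ i →
      ((eX a : Matrix.SpecialLinearGroup (Fin d) ℤ) : Matrix (Fin d) (Fin d) ℤ) i j =
        if i = j then 1 else 0 :=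
    fun a => hU _ (Finset.mem_union_left _ (Finset.mem_union_left _ (eX a).2))
  have hY : ∀ b : Fin Y.card, ∀ i j : Fin d, j ≤ i →
      ((eY b : Matrix.SpecialLinearGroup (Fin d) ℤ) : Matrix (Fin d) (Fin d) ℤ) i j =
        if i = j then 1 else 0 :=
    fun b => hU _ (Finset.mem_union_left _ (Finset.mem_union_right _ (eY b).2))
  have hZ : ∀ c : Fin Z.card, ∀ i j : Fin d, j ≤ i →
      ((eZ c : Matrix.SpecialLinearGroup (Fin d) ℤ) : Matrix (Fin d) (Fin d) ℤ) i j =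
        if i = j then 1 else 0 :=
    fun c => hU _ (Finset.mem_union_right _ (eZ c).2)
  -- the reading functionals `ℓ a c := ℓ_{p_{x_a z_c}}` and the separation pattern they read
  have key : ∀ (a : Fin X.card) (c : Fin Z.card),
      ∃ ℓ : Matrix (Fin N) (Fin N) (MvPolynomial (Fin k) ℂ ⧸
          Ideal.span (Set.range fun i : Fin k => (MvPolynomial.X i : MvPolynomial (Fin k) ℂ) ^ t))
          →ₗ[ℂ] ℂ,
        ∀ (a' : Fin X.card) (b b' : Fin Y.card) (c' : Fin Z.card),
          ℓ (ρ ((eX a' : Matrix.SpecialLinearGroup (Fin d) ℤ) *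
                (eY b : Matrix.SpecialLinearGroup (Fin d) ℤ)⁻¹) *
              ρ ((eY b' : Matrix.SpecialLinearGroup (Fin d) ℤ) *
                (eZ c' : Matrix.SpecialLinearGroup (Fin d) ℤ)⁻¹)) =
            if a' = a ∧ b = b' ∧ c' = c then 1 else 0 := by
    intro a c
    obtain ⟨p, hp, hsep⟩ := hS _ (eX a).2 _ (eZ c).2
    obtain ⟨ℓ, hℓ⟩ := hρ p hp
    refine ⟨ℓ, fun a' b b' c' => ?_⟩
    rw [hℓ _ _ (unitriangular_mul_inv _ _ (hX a') (hY b)) (unitriangular_mul_inv _ _ (hY b') (hZ c')),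
      ← mul_assoc, hsep _ (eX a').2 _ (eY b).2 _ (eY b').2 _ (eZ c').2]
    simp only [Subtype.val_inj, Equiv.apply_eq_iff_eq]
  choose ℓ hℓ using key
  exact hosting_of_pattern _ _ ℓ hℓ

end Summit.MatrixMultiplication.MatrixMultiplication.Theorems.UnitriangularCostShape
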